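import Summits.BirchSwinnertonDyer.BirchSwinnertonDyer.Theses.AdditiveBranchIMC
import Summits.BirchSwinnertonDyer.BirchSwinnertonDyer.Theorems.AdditiveBranchIMCGordTwoRankOneHeegnerKolyvaginSelfTwistUnitsFrame
import HarnessLib

/-!
# Negative lemma for route `AdditiveBranchIMC`, support item `SelfTwistJSWIndexBound`
# (stmt-BirchSwinnertonDyer-23009): the unit-free self-twist index bound is FALSE at `p = 3`
# modulo the existence of one BSD-consistent row — `¬ SelfTwistJSWIndexBound` modulo `H`

REFUTER FILE (negative lane, `Theorems/SelfTwistJSWIndexBound/Negative/`). THEOREMS + ONE `def H : Prop`;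
no `sorry`, no new named fact; nothing positive about a Theses decl is concluded.

THE ITEM (route file `Theses/AdditiveBranchIMC.lean`, decl `SelfTwistJSWIndexBound`) asserts, for EVERY prime
`p` (binder `(p : ℕ) [Fact p.Prime]`, no `5 ≤ p`), every imaginary quadratic `K` with `d_K = −p`, every GOOD
rank-zero curve `V` with onto `ρ̄_{V,p}` and every globally minimal model `W = Cd • V^{(d_K)}` of analytic rank `1`
on cell (G-ord, `e = 2`), at every Manin-good Heegner frame `P ∈ V(K)`:
`2·v_p[V(K):ℤP] ≤ v_p #Ш(V/K) + v_p ∏c(V) + v_p ∏c(W)` (no unit term).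

THE MECHANISM OF FAILURE (classification: `refuted-misstated` IF `H` below were constructible in the tree).
Part 22a's kernel identity `exists_shaAn_twist_padicVal_eq_of_heegner_rankZero_units` (Gross–Zagier for `V/K`
÷ Gross–Zagier-for-`L(V,1)` ÷ BSD-shaped bookkeeping, PUBLISHED inputs by name) reads, at such a frame,
`2·v_p[V(K):ℤP] = v_p Ш_an(V) + v_p Ш_an(W) + v_p ∏c(V) + v_p ∏c(W) + 2·v_p #μ(K)`.
At `p = 3` the field is `K = ℚ(√−3)`, `#μ(K) = 6`, `2·v_3 #μ(K) = 2` (this file proves `3 ∣ #μ(K)` from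
`d_K = −3`: `(−1 + √d_K)/2` is a primitive cube root of unity). Hence the item, read at a `p = 3` frame, says
`v_3 Ш_an(V) + v_3 Ш_an(W) + 2 ≤ v_3 #Ш(V) + v_3 #Ш(W)`; Wuthrich 2014 Prop. 21 (PUBLISHED, tree fact
`Wuthrich2014.sha_dvd_analyticSha`; `V` good at `3`, `ρ̄_{V,3}` onto, rank `0`) gives `v_3 #Ш(V) ≤ v_3 Ш_an(V)`, so
the item FORCES `v_3 #Ш(W) ≥ v_3 Ш_an(W) + 2` on every `p = 3` row of the cell
(`padicValNat_shaOrder_ge_of_selfTwistJSWIndexBound_at_three`) — i.e. it contradicts the UPPER half of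
`BSD(W,3)` (a fortiori `BSD(W,3)` itself) on every such row. For `p ≥ 5` (`#μ(K) = 2`) the item is
BSD-consistent (Part 22e, `selfTwistIndexBound_of_missingLowerBounds`): the defect is the missing side
condition `5 ≤ p` / the missing unit term, not the mechanism.

REPAIRED STATEMENT `C′` (already filed and stamped): item stmt-BirchSwinnertonDyer-23086
`SelfTwistJSWIndexBoundUnits` = the same inequality `+ 2 * padicValNat p (NumberField.Units.torsionOrder K)`;
the witness MISSES `C′` (with the unit term the `p = 3` reading is `LOWER(V,3) + LOWER(W,3)`-consistent, Part 22b).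
Equivalent repair: `5 ≤ p →` as first hypothesis (Part 21c §4b, `…_of_selfTwistIndexBoundFive`).

WHY ONLY MODULO `H`. An unconditional `¬ SelfTwistJSWIndexBound` needs ONE actual row at `p = 3`: a globally
minimal `W/ℚ` with `ord_{s=1} L(W,s) = 1`, additive potentially-good-ordinary at `3` with `e = 2`, `ρ̄_{W,3}`
onto, the Heegner condition for `N_W/9` in `ℚ(√−3)`, `L(W^{(−3)},1) ≠ 0`, and `v_3 #Ш(W) ≤ v_3 Ш_an(W)`.
Such rows abound numerically (Cremona's tables), but the tree cannot certify an analytic rank, a central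
`L`-value or `#Ш` of an explicit curve, nor does it hold Gross–Zagier / Kolyvagin / GZK / modularity /
Wuthrich / newforms / Mazur / Néron scaling other than as statement-only named facts. `H` bundles exactly these:
the eight PUBLISHED facts by name and the existence of one BSD-upper-consistent `p = 3` row.

* `three_dvd_unitsTorsionOrder_of_discr_eq_neg_three` — `[K:ℚ] = 2`, `d_K = −3` ⟹ `3 ∣ #μ(K)`.
* `padicValNat_shaOrder_ge_of_selfTwistJSWIndexBound_at_three` — PUBLISHED facts + the ITEM ⟹ on every
  `p = 3` row: `∃ q, Ш_an(W) = q ∧ v_3 q + 2 ≤ v_3 #Ш(W)`.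
* `UpperConsistentGordTwoRowAtThree` (`H`) and
  `SelfTwistJSWIndexBound_false_of_UpperConsistentGordTwoRowAtThree : H → ¬ SelfTwistJSWIndexBound`.

References: [JetchevSkinnerWan2017] §7.4.1 (pp. 29–31); [GrossZagier1986] I.(6.5) (`u = #𝓞_K^×/2`), V.§2;
[Wuthrich2014] Prop. 21 (p. 400); [Mazur1978] Cor. 4.1; [Miller2011LMS] Def. 1.1; [Washington1997] Ch. 1
(roots of unity of `ℚ(√−3)`). [folklore] for `#μ(ℚ(√−3)) = 6`.
-/

set_option autoImplicit false
set_option linter.dupNamespace false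
noncomputable section

open scoped Classical NumberField
open WeierstrassCurve NumberField IsDedekindDomain
  Literature.NumberTheory.EllipticCurves Literature.NumberTheory.EllipticCurves.ModularForms
  Literature.NumberTheory.EllipticCurves.Rank1Residual
  Literature.NumberTheory.EllipticCurves.Rank1Residual.Typed
  Summit.BirchSwinnertonDyer.Rank1Residual
  Summit.BirchSwinnertonDyer.Rank1Residual.Additive
  Summit.BirchSwinnertonDyer.BirchSwinnertonDyer.Theorems.AdditiveBranchIMCGordTwoRankOne.HeegnerKolyvagin

namespace Summit.BirchSwinnertonDyer.BirchSwinnertonDyer.Theorems.SelfTwistJSWIndexBound.Negative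

/-! ### §1 The sixth roots of unity of `ℚ(√−3)`: `3 ∣ #μ(K)` when `d_K = −3` -/

/-- **`3 ∣ #μ(K)` for the quadratic field of discriminant `−3`.** From `δ ∈ 𝓞 K` with `δ² = d_K = −3`
(`Quadratic.exists_sq_eq_discr`), `z = (δ − 1)/2 ∈ K` satisfies `z² + z + 1 = 0`, so `z` is a primitive cube
root of unity and `3 ∣ torsionOrder K` (`NumberField.Units.dvd_torsionOrder_of_isPrimitiveRoot`). [folklore] -/
theorem three_dvd_unitsTorsionOrder_of_discr_eq_neg_three (K : Type) [Field K] [NumberField K]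
    (h2 : Module.finrank ℚ K = 2) (hdisc : NumberField.discr K = -3) : 3 ∣ Units.torsionOrder K := by
  obtain ⟨-, -, δ, -, hδ⟩ := Literature.NumberTheory.QuadraticFields.Quadratic.exists_sq_eq_discr (K := K) h2
  obtain ⟨d, hd⟩ : ∃ d : K, d ^ 2 = -3 := by
    refine ⟨algebraMap (𝓞 K) K δ, ?_⟩
    have h := congrArg (algebraMap (𝓞 K) K) hδ
    rw [map_pow, map_intCast, hdisc] at h
    rw [h]; norm_num
  obtain ⟨z, hz⟩ : ∃ z : K, z ^ 2 + z + 1 = 0 := ⟨(d - 1) / 2, by linear_combination (1 / 4 : K) * hd⟩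
  have hz3 : z ^ 3 = 1 := by linear_combination (z - 1) * hz
  have hz1 : z ≠ 1 := by
    intro h; rw [h] at hz; norm_num at hz
  have hz2 : z ^ 2 ≠ 1 := by
    intro h
    have h' : z = -2 := by linear_combination hz - h
    rw [h'] at h; norm_num at h
  have hprim : IsPrimitiveRoot z 3 := IsPrimitiveRoot.mk_of_lt z (by norm_num) hz3 (by
    intro l hl0 hl3
    interval_cases l
    · simpa using hz1
    · exact hz2)
  exact NumberField.Units.dvd_torsionOrder_of_isPrimitiveRoot hprim

/-! ### §2 What the item forces at `p = 3`: `v_3 #Ш(W) ≥ v_3 Ш_an(W) + 2` on every row of the cell -/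

/-- **THE ITEM PROVES TOO MUCH AT `p = 3`.** PUBLISHED facts by name (Gross–Zagier, Kolyvagin qualitative,
GZK, modularity, Wuthrich 2014 Prop. 21, newforms, Mazur 1978 Cor. 4.1, Néron scaling) + the item
`SelfTwistJSWIndexBound` (hypothesis `hS`) ⟹ for every globally minimal `W/ℚ` with `ord_{s=1}L(W,s) = 1` on cell
(G-ord, `e = 2`) at `p = 3` with `ρ̄_{W,3}` onto, every imaginary quadratic `K` with `d_K = −3` in which every prime
`ℓ ≠ 3` of `N_W` splits, and `L(W^{(−3)},1) ≠ 0`: `v_3 Ш_an(W) + 2 ≤ v_3 #Ш(W)`. Assembly verbatim as Part 21c's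
`cellGordTwo_missingLowerBoundAt_rankOne_of_selfTwistIndexBound` (the good `3*`-twist `V`, the Heegner hypothesis
for `N_V`, a Manin-good frame), then Part 22a's identity with `2·v_3 #μ(K) ≥ 2` and Wuthrich's UPPER(V,3).
[cite: JetchevSkinnerWan2017, §7.4.1, pp. 29–31] [cite: GrossZagier1986, I.(6.5)] [cite: Wuthrich2014, Prop. 21 (p. 400)]
[cite: Mazur1978, Cor. 4.1] [cite: Miller2011LMS, Def. 1.1] -/
theorem padicValNat_shaOrder_ge_of_selfTwistJSWIndexBound_at_three
    (hGZ : ∀ (N : ℕ) [NeZero N] (V : WeierstrassCurve ℚ) (K : Type) [Field K] [NumberField K], gross_zagier N V K)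
    (hKo : ∀ (N : ℕ) [NeZero N] (V : WeierstrassCurve ℚ) (K : Type) [Field K] [NumberField K], kolyvagin N V K)
    (hGZK : rank_eq_analyticRank_of_analyticRank_le_one) (hmod : hasEntireLFunction_rat)
    (hW21 : Wuthrich2014.sha_dvd_analyticSha) (hnf : exists_isNewformOf)
    (hMaz : mazur_not_dvd_maninConstant_of_odd) (hNS : integral_neronScaling_of_isGloballyMinimal)
    (hS : Summit.BirchSwinnertonDyer.BirchSwinnertonDyer.Theses.AdditiveBranchIMC.SelfTwistJSWIndexBound)
    (W : WeierstrassCurve ℚ) [W.IsElliptic] [W.IsGloballyMinimal] (K : Type) [Field K] [NumberField K]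
    (hr : W.analyticRank = 1) (hc2 : N10.CellGordTwo W 3) (hsurj : W.HasSurjectiveModNGaloisRep 3)
    (hK : IsImaginaryQuadratic K) (hdisc : NumberField.discr K = -3)
    (hHeeg : ∀ ℓ : ℕ, ℓ.Prime → (ℓ : ℤ) ∣ ↑(W.conductorNorm ℤ) → ℓ ≠ 3 →
      ((Ideal.span {(ℓ : ℤ)}).primesOver (𝓞 K)).ncard = 2)
    (hLt : (W.quadraticTwist (-(3 : ℚ))).entireLFunction 1 ≠ 0) :
    ∃ q : ℚ, shaAn W = (q : ℂ) ∧ padicValRat 3 q + 2 ≤ padicValNat 3 W.shaOrder := by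
  obtain ⟨hp2, hadd, hG, he⟩ := hc2
  have hdisc' : NumberField.discr K = -((3 : ℕ) : ℤ) := by rw [hdisc]; norm_num
  -- the good ordinary `3*`-twist `V`, `3* = −3 = d_K`
  obtain ⟨V, _, _, ⟨C, hC⟩, hord⟩ := TypeGOrd.exists_goodOrd_model_twist_pStar W 3 hp2 hG hadd he
  have hVgood : V.HasGoodReductionAtPrime 3 := hord.1
  have hps : ((-1 : ℚ) ^ ((3 : ℕ) / 2) * ((3 : ℕ) : ℚ)) = (NumberField.discr K : ℚ) := by
    rw [hdisc]; norm_num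
  have hD0 : (NumberField.discr K : ℚ) ≠ 0 := by exact_mod_cast NumberField.discr_ne_zero K
  have hC' : C • W.quadraticTwist (NumberField.discr K : ℚ) = V := by rw [← hps]; exact hC
  obtain ⟨Cd, hCd⟩ := exists_variableChange_quadraticTwist_symm V W hD0 ⟨C, hC'⟩
  have hCd' : Cd • V.quadraticTwist ((-1 : ℚ) ^ ((3 : ℕ) / 2) * ((3 : ℕ) : ℚ)) = W := by rw [hps]; exact hCd
  haveI : NeZero (V.conductorNorm ℤ) := ⟨(V.conductorNorm_pos_holds).ne'⟩
  -- the Heegner hypothesis for `N_V`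
  have hHN : SatisfiesHeegnerHypothesis (V.conductorNorm ℤ) K := by
    intro ℓ hℓ hℓV
    have hℓV' : ℓ ∣ V.conductorNorm ℤ := by exact_mod_cast hℓV
    have hℓW : ℓ ∣ W.conductorNorm ℤ :=
      AdditiveBranchIMCMultLower.dvd_conductorNorm_of_dvd_conductorNorm_twist_model hp2 V W Cd hCd' hadd hℓ hℓV'
    have hℓp : ℓ ≠ 3 := by
      rintro rfl
      exact (V.dvd_conductorNorm_iff_not_hasGoodReductionAtPrime 3).mp hℓV' hVgood
    exact hHeeg ℓ hℓ (by exact_mod_cast hℓW) hℓp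
  -- the image of `V`
  have hsurjV : V.HasSurjectiveModNGaloisRep 3 := by
    have h := (GaloisImage.hasSurjectiveModNGaloisRep_pow_iff_of_model_twist V 3 hD0 ⟨Cd, hCd⟩ 1)
    rw [pow_one] at h
    exact h.mp hsurj
  haveI : NeZero ((3 : ℕ) : ℚ) := ⟨by norm_num⟩
  have hirrV : V.HasIrreducibleModPGaloisRep 3 :=
    hasIrreducibleModPGaloisRep_of_hasSurjectiveModNGaloisRep V 3 hsurjV
  -- `L(V,1) ≠ 0`
  have hLV : V.entireLFunction 1 ≠ 0 := by
    haveI : (W.quadraticTwist (NumberField.discr K : ℚ)).IsElliptic := W.isElliptic_quadraticTwist hD0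
    have hVL : V.entireLFunction = (W.quadraticTwist (NumberField.discr K : ℚ)).entireLFunction := by
      rw [← hC', entireLFunction_smul]
    have hdq : (NumberField.discr K : ℚ) = -(3 : ℚ) := by rw [hdisc]; norm_num
    rw [hVL, hdq]; exact hLt
  -- the Manin-good Heegner frame of `V` over `K` (Mazur at the GOOD prime `3` of `V`)
  obtain ⟨Dt, H, ι, P, hP, hc⟩ :=
    X11b.exists_maninDatum_of_good hnf hMaz hNS V 3 (V.conductorNorm ℤ) K rfl hp2 hVgood hirrV hK hHN
  -- the published inputs, read at the frame
  have hr0 : V.analyticRank = 0 := (V.analyticRank_eq_zero_iff_holds (hmod V)).2 hLV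
  have hu : padicValRat 3 (Cd.u : ℚ) = 0 :=
    padicValRat_u_eq_zero_of_good_of_twist_discr_eq_neg V W 3 hp2 hVgood K hdisc' Cd hCd
  obtain ⟨q', hq', hupV⟩ : Typed.MissingUpperBoundAt V 3 :=
    Typed.missingUpperBoundAt_of_wuthrich V 3 hW21 hGZK hmod hp2 hr0
      (WeierstrassCurve.HasGoodReduction.not_hasAdditiveReduction (R := ℤ_[3]) hVgood) (Or.inr hsurjV)
  obtain ⟨hqW, hvqW⟩ := exists_centralValue_div_realPeriod_eq_of_shaAn_eq_rankZero hGZK hmod V 3 hr0 hq'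
  obtain ⟨-, hfinK, hsha, q, hq, hval⟩ := exists_shaAn_twist_padicVal_eq_of_heegner_rankZero_units V 3
    (V.conductorNorm ℤ) K Dt H ι P (hGZ _ V K) (hKo _ V K) hGZK hmod hK hHN hP hp2 hc hr0 _ hqW W Cd hCd hr
  -- the ITEM, read at the frame
  have hSf := hS V 3 K W Cd Dt H ι P hVgood hLV hsurjV hK hdisc' hHN hCd hr ⟨hp2, hadd, hG, he⟩ hP hc hfinK
  -- `2 · v_3 #μ(K) ≥ 2`
  have hw : 1 ≤ padicValNat 3 (Units.torsionOrder K) :=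
    one_le_padicValNat_of_dvd (Units.torsionOrder_ne_zero K)
      (three_dvd_unitsTorsionOrder_of_discr_eq_neg_three K hK.1 hdisc)
  refine ⟨q, hq, ?_⟩
  have e2 : (padicValNat 3 (V.baseChange K).shaOrder : ℤ) =
      padicValNat 3 V.shaOrder + padicValNat 3 W.shaOrder := by exact_mod_cast hsha
  rw [hvqW, hu] at hval
  omega

/-! ### §3 `¬ SelfTwistJSWIndexBound` modulo `H` -/

/-- **`H`: the eight PUBLISHED facts by name, and ONE `p = 3` row of cell (G-ord, `e = 2`) on which the UPPER
half of `BSD(W,3)` holds.** Conjuncts 1–8: Gross–Zagier and Kolyvagin (qualitative) for every `(N, V, K)`, GZK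
(bsd.S17), modularity, Wuthrich 2014 Prop. 21, existence of newforms, Mazur 1978 Cor. 4.1, integral Néron scaling
— statement-only Literature facts. Conjunct 9: a globally minimal `W/ℚ` with `ord_{s=1}L(W,s) = 1`, additive
potentially-good-ordinary at `3` with `e = 2`, `ρ̄_{W,3}` onto, an imaginary quadratic `K` with `d_K = −3` in which
every prime `ℓ ≠ 3` of `N_W` splits, `L(W^{(−3)},1) ≠ 0`, and `v_3 #Ш(W) ≤ v_3 Ш_an(W)` (`Typed.MissingUpperBoundAt W 3`,
a consequence of `BSD(W,3)`). NOT CONSTRUCTIBLE in the tree today (analytic rank / `L`-values / `#Ш` of an explicit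
curve; the eight facts are named, not proved); numerically such rows abound. This is the construction hypothesis `H`
of a negative lemma, not a published fact (no citation tag). -/
def UpperConsistentGordTwoRowAtThree : Prop :=
  (∀ (N : ℕ) [NeZero N] (V : WeierstrassCurve ℚ) (K : Type) [Field K] [NumberField K], gross_zagier N V K) ∧
  (∀ (N : ℕ) [NeZero N] (V : WeierstrassCurve ℚ) (K : Type) [Field K] [NumberField K], kolyvagin N V K) ∧
  rank_eq_analyticRank_of_analyticRank_le_one ∧ hasEntireLFunction_rat ∧
  Wuthrich2014.sha_dvd_analyticSha ∧ exists_isNewformOf ∧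
  mazur_not_dvd_maninConstant_of_odd ∧ integral_neronScaling_of_isGloballyMinimal ∧
  ∃ (W : WeierstrassCurve ℚ) (_ : W.IsElliptic) (_ : W.IsGloballyMinimal)
    (K : Type) (_ : Field K) (_ : NumberField K),
    W.analyticRank = 1 ∧ N10.CellGordTwo W 3 ∧ W.HasSurjectiveModNGaloisRep 3 ∧
    IsImaginaryQuadratic K ∧ NumberField.discr K = -3 ∧
    (∀ ℓ : ℕ, ℓ.Prime → (ℓ : ℤ) ∣ ↑(W.conductorNorm ℤ) → ℓ ≠ 3 →
      ((Ideal.span {(ℓ : ℤ)}).primesOver (𝓞 K)).ncard = 2) ∧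
    (W.quadraticTwist (-(3 : ℚ))).entireLFunction 1 ≠ 0 ∧
    Typed.MissingUpperBoundAt W 3

/-- **`¬ SelfTwistJSWIndexBound` MODULO `H`** (negative lemma; the item stays open but held). Classification IF
`H` were constructible: `refuted-misstated` — the witness is the `p = 3` sub-row (`K = ℚ(√−3)`, `#μ(K) = 6`), a
degenerate case the planner did not intend (the producing theorem's docstring says `p ≥ 5`); REPAIRED statement
`C′` = item stmt-BirchSwinnertonDyer-23086 `SelfTwistJSWIndexBoundUnits` (unit term `+ 2·v_p #μ(K)`), equivalently
`5 ≤ p →` first (Part 21c §4b); the witness misses `C′`. Proof: §2 gives `v_3 Ш_an(W) + 2 ≤ v_3 #Ш(W)`, the row's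
UPPER half gives `v_3 #Ш(W) ≤ v_3 Ш_an(W)` (same rational `Ш_an(W)` by injectivity of `ℚ → ℂ`).
[cite: JetchevSkinnerWan2017, §7.4.1, pp. 29–31] [cite: GrossZagier1986, I.(6.5)] [cite: Wuthrich2014, Prop. 21 (p. 400)] -/
theorem SelfTwistJSWIndexBound_false_of_UpperConsistentGordTwoRowAtThree :
    UpperConsistentGordTwoRowAtThree →
      ¬ Summit.BirchSwinnertonDyer.BirchSwinnertonDyer.Theses.AdditiveBranchIMC.SelfTwistJSWIndexBound := by
  rintro ⟨hGZ, hKo, hGZK, hmod, hW21, hnf, hMaz, hNS, W, _, _, K, _, _, hr, hc2, hsurj, hK, hdisc, hHeeg, hLt,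
    q', hq', hup⟩ hS
  obtain ⟨q, hq, hle⟩ := padicValNat_shaOrder_ge_of_selfTwistJSWIndexBound_at_three hGZ hKo hGZK hmod hW21 hnf
    hMaz hNS hS W K hr hc2 hsurj hK hdisc hHeeg hLt
  have hqq : q' = q := by exact_mod_cast hq'.symm.trans hq
  subst hqq
  omega

end Summit.BirchSwinnertonDyer.BirchSwinnertonDyer.Theorems.SelfTwistJSWIndexBound.Negative

end
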